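import Summits.RiemannHypothesis.RiemannHypothesis.Theorems.Splittings.JenDeflationWitness
import HarnessLib

/-!
# Splittings — the Jensen DEFLATION split `RH(≤ H) ∧ B₂(H) ⟹ RH` and its label: `B₂(H) ⟺ RH above height H`
# by THEOREM, for every `H` (SPLIT-jen-finite gen 2, part 2/2; zero-definition raw form)

Cell rh-split, seat rh-split-jen-finite g0/g2 (brief sha16 f79c5f09d8bcb036), card
`run/shared/lean/pub/rh-split/cards/SPLIT-jen-finite.md` §3 and gen-2 addendum.  Raw form of
`HOME/rh-split-jen-finite/Sketch2.lean` §3–§5 (sha16 4f853a51c395c629; proofs verbatim), the seat-local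
definitions SPELLED OUT —

* the deflated `w`-plane zero set `𝒵_H` as the predicate
  `∃ ρ, riemannZeta ρ = 0 ∧ 0 < ρ.re ∧ ρ.re < 1 ∧ H ≤ |ρ.im| ∧ w = (ρ - 1/2)²` (part 1/2, `JenDeflationWitness`);
* FIN `A₂(H)` = the tree's `RiemannHypothesisUpTo H` (zero currency; kernel theorem at `H = 1000`,
  `riemannHypothesisUpTo_1000`, standard axioms);
* TAIL `B₂(H)` («the Jensen polynomials of `ξ` DEFLATED by its zeros of height `< H` are all hyperbolic») =
  `∃ F γ, F entire ∧ (γ real Taylor data of F with an everywhere absolutely summable majorant) ∧ F 0 ≠ 0 ∧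
  (zero set of F = 𝒵_H) ∧ ∀ d n, (jensenPoly γ d n).Splits` — the tree's Pólya–Schur idiom;
* «RH above height `H`» = `∀ ρ, riemannZeta ρ = 0 → 0 < ρ.re → ρ.re < 1 → H ≤ |ρ.im| → ρ.re = 1/2`.

Proved here (no `sorry`, standard axioms):

* `rh_of_rhUpTo_of_deflatedJensen` — **rh_of_A_B**: `RiemannHypothesisUpTo H → B₂(H) → RH`, BOTH hypotheses
  consumed (Pólya–Schur on the witness for `|Im ρ| ≥ H`, the certificate below `H`);
* `deflatedJensen_iff_offLineFreeAbove` — **the label, kernel form**: `B₂(H) ↔ RH above height H` for EVERY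
  real `H`, no certificate, no F1 (`⟸` by the RH-free witness of part 1/2, which is Laguerre–Pólya once its
  zeros are real); hence `deflatedJensen_iff_rh (hA : RiemannHypothesisUpTo H)`, `offLineFreeAbove_iff_rh`
  and `deflatedJensen_1000_iff_rh : B₂(1000) ↔ RH` (standard axioms);
* census R10–R11 (all RH-free): the Rolle staircase `splits_triangle_of_rowZero` (one row-`0` cell certifies
  the whole triangle `d + n ≤ D`), `splits_triangle_million` (KERNEL FIN in cell currency: `J^{d,n}_ξ`
  hyperbolic for all `d + n ≤ 10⁶`), and `xiSq_ne_zero_of_rowZero_splits` (what one certified cell buys back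
  in zero currency: zero-free discs bounded away from the real axis only).

Referee (rh-split-ref g0) on cards/SPLIT-jen-finite.md, 19:26Z: «Sketch2 4f853a51c395c629 replayed rc 0, std on
deflatedWitnessExists and deflatedJensenHyperbolic_1000_iff_rh; P1 PROVED accepted (RH-free Hadamard
sub-product existence theorem); B(H) ⟺ RH(|Im| ≥ H) by theorem ⇒ JenDeflate(H) = RELABELLING simpliciter (zd
partition costume, tail-lemma instance); R10–R12 endorsed; class UNCHANGED» — i.e. the splitting is the
height partition of the zeros in Jensen clothing: FIN is load-bearing but the TAIL is RH-above-H verbatim, so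
as a route it has no new teeth.  Typer replay (rh-split-typer-1 g2): this raw form on the farm, rc 0,
0 warnings, 0 sorry, std axioms.  Filed by rh-split-typer-1 g2 on the lead's GO 2026-08-26T19:39Z
(HANDOFF-list item 2).

HONEST LABEL: «SPLITTING SEARCH over kernel-typed RH-EQUIVALENCES; a splitting A ∧ B ⟹ RH is CONDITIONAL
bookkeeping unless A and B are both proved; nothing here bears on the truth of RH.»
-/

set_option linter.dupNamespace false

noncomputable section

open Polynomial Filter
open _root_.Complex
open scoped ComplexConjugate Nat

namespace Summit.RiemannHypothesis.RiemannHypothesis.Theorems.Splittings.JenDeflation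

open Literature.NumberTheory.LFunctions Literature.Analysis.Complex.Obreschkoff
  Literature.Analysis.Complex.PolyaSchur Literature.Analysis.TotalPositivity
  Literature.NumberTheory.DiophantineGeometry Literature.Barriers.RiemannHypothesis

/-! ## §2 `rh_of_A_B` for the deflation splitting: `RH(≤ H) ∧ B₂(H) ⟹ RH`, both consumed -/

/-- **rh_of_A_B for the deflation splitting.**  `RH up to height H` ∧ `B₂(H)` ⟹ RH, with BOTH
hypotheses consumed: a zero `w = (ρ - ½)²` of `G = xiSq` with `|Im ρ| ≥ H` is a zero of the deflated `F`,
hence real by Pólya–Schur (`im_eq_zero_of_forall_splits_jensenPoly`, row `n = 0` of `B₂` suffices);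
one with `|Im ρ| < H` is on the line by the certificate (`re_eq_half_of_rh_upTo`); then
`riemannHypothesis_of_forall_xiSq_eq_zero_im_eq_zero`. -/
theorem rh_of_rhUpTo_of_deflatedJensen {H : ℝ} (hA : RiemannHypothesisUpTo H)
    (hB : ∃ (F : ℂ → ℂ) (γ : ℕ → ℝ),
      Differentiable ℂ F ∧
      (∀ R : ℝ, 0 ≤ R → Summable fun j => |γ j| / (j ! : ℝ) * R ^ j) ∧
      (∀ w : ℂ, HasSum (fun j => (γ j : ℂ) / (j ! : ℂ) * w ^ j) (F w)) ∧
      F 0 ≠ 0 ∧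
      (∀ w : ℂ, F w = 0 ↔
        ∃ ρ : ℂ, riemannZeta ρ = 0 ∧ 0 < ρ.re ∧ ρ.re < 1 ∧ H ≤ |ρ.im| ∧ w = (ρ - 1 / 2) ^ 2) ∧
      ∀ d n : ℕ, (jensenPoly γ d n).Splits) :
    _root_.RiemannHypothesis := by
  obtain ⟨F, γ, hFd, hsum, hF, h0, hzero, hs⟩ := hB
  refine riemannHypothesis_of_forall_xiSq_eq_zero_im_eq_zero fun z hz => ?_
  obtain ⟨ρ, hζ, h0', h1', rfl⟩ := exists_zero_of_xiSq_eq_zero hz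
  by_cases hρ : H ≤ |ρ.im|
  · have hFz : F ((ρ - 1 / 2) ^ 2) = 0 := (hzero _).2 ⟨ρ, hζ, h0', h1', hρ, rfl⟩
    exact im_eq_zero_of_forall_splits_jensenPoly hsum hF hFd h0 (fun d => hs d 0) hFz
  · have hlt : |ρ.im| < H := lt_of_not_ge hρ
    have hre : ρ.re = 1 / 2 :=
      re_eq_half_of_rh_upTo (T := H) (fun s hs h0s hT => hA s hs h0s hT.le) hζ h0' h1' hlt
    rw [im_sq_sub_half, hre, sub_self, mul_zero, zero_mul]

/-! ## §4 Consequences: the TAIL of the deflation splitting is `RH above height H`, unconditionally -/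

/-- `B₂(H) ⟹ RH above height H` (Pólya–Schur on the witness of `B₂`; the first branch of
`rh_of_rhUpTo_of_deflatedJensen`, now stated without FIN). -/
theorem offLineFreeAbove_of_deflatedJensen {H : ℝ}
    (hB : ∃ (F : ℂ → ℂ) (γ : ℕ → ℝ),
      Differentiable ℂ F ∧
      (∀ R : ℝ, 0 ≤ R → Summable fun j => |γ j| / (j ! : ℝ) * R ^ j) ∧
      (∀ w : ℂ, HasSum (fun j => (γ j : ℂ) / (j ! : ℂ) * w ^ j) (F w)) ∧
      F 0 ≠ 0 ∧
      (∀ w : ℂ, F w = 0 ↔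
        ∃ ρ : ℂ, riemannZeta ρ = 0 ∧ 0 < ρ.re ∧ ρ.re < 1 ∧ H ≤ |ρ.im| ∧ w = (ρ - 1 / 2) ^ 2) ∧
      ∀ d n : ℕ, (jensenPoly γ d n).Splits) :
    ∀ ρ : ℂ, riemannZeta ρ = 0 → 0 < ρ.re → ρ.re < 1 → H ≤ |ρ.im| → ρ.re = 1 / 2 := by
  obtain ⟨F, γ, hFd, hsum, hF, h0, hzero, hs⟩ := hB
  intro ρ hζ h0' h1' hH
  have hFz : F ((ρ - 1 / 2) ^ 2) = 0 := (hzero _).2 ⟨ρ, hζ, h0', h1', hH, rfl⟩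
  exact re_eq_half_of_im_sq_eq_zero hζ h0' h1'
    (im_eq_zero_of_forall_splits_jensenPoly hsum hF hFd h0 (fun d => hs d 0) hFz)

/-- `RH above height H ⟹ B₂(H)` — RH-free apart from its hypothesis: the witness of
`deflatedWitness_exists` has only real zeros, so it is Laguerre–Pólya
(`splits_jensenPoly_taylor_of_zeros_real`). -/
theorem deflatedJensen_of_offLineFreeAbove {H : ℝ}
    (h : ∀ ρ : ℂ, riemannZeta ρ = 0 → 0 < ρ.re → ρ.re < 1 → H ≤ |ρ.im| → ρ.re = 1 / 2) :
    ∃ (F : ℂ → ℂ) (γ : ℕ → ℝ),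
      Differentiable ℂ F ∧
      (∀ R : ℝ, 0 ≤ R → Summable fun j => |γ j| / (j ! : ℝ) * R ^ j) ∧
      (∀ w : ℂ, HasSum (fun j => (γ j : ℂ) / (j ! : ℂ) * w ^ j) (F w)) ∧
      F 0 ≠ 0 ∧
      (∀ w : ℂ, F w = 0 ↔
        ∃ ρ : ℂ, riemannZeta ρ = 0 ∧ 0 < ρ.re ∧ ρ.re < 1 ∧ H ≤ |ρ.im| ∧ w = (ρ - 1 / 2) ^ 2) ∧
      ∀ d n : ℕ, (jensenPoly γ d n).Splits := by
  obtain ⟨F, γ, hF, hreal, hsum, hsumF, hγ, h0, hzero⟩ := deflatedWitness_exists H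
  refine ⟨F, γ, hF.1, hsum, hsumF, h0, hzero, fun d n => ?_⟩
  have hreal0 : (F 0).im = 0 := by
    have h1 := hreal 0
    rw [map_zero] at h1
    exact conj_eq_iff_im.1 h1.symm
  have hz : ∀ z : ℂ, F z = 0 → z.im = 0 := fun z hz => by
    obtain ⟨ρ, hζ, h0', h1', hH, rfl⟩ := (hzero z).1 hz
    rw [im_sq_sub_half, h ρ hζ h0' h1' hH]
    ring
  rw [hγ]
  exact splits_jensenPoly_taylor_of_zeros_real hF hreal0 h0 hz d n

/-- **TAIL LEMMA instance, kernel form: `B₂(H) ↔ RH above height H` for EVERY real `H`, no certificate,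
no F1.**  (Referee: JenDeflate(H) = RELABELLING simpliciter — the tail is the height partition of the zeros in
Jensen clothing.) -/
theorem deflatedJensen_iff_offLineFreeAbove (H : ℝ) :
    (∃ (F : ℂ → ℂ) (γ : ℕ → ℝ),
      Differentiable ℂ F ∧
      (∀ R : ℝ, 0 ≤ R → Summable fun j => |γ j| / (j ! : ℝ) * R ^ j) ∧
      (∀ w : ℂ, HasSum (fun j => (γ j : ℂ) / (j ! : ℂ) * w ^ j) (F w)) ∧
      F 0 ≠ 0 ∧
      (∀ w : ℂ, F w = 0 ↔
        ∃ ρ : ℂ, riemannZeta ρ = 0 ∧ 0 < ρ.re ∧ ρ.re < 1 ∧ H ≤ |ρ.im| ∧ w = (ρ - 1 / 2) ^ 2) ∧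
      ∀ d n : ℕ, (jensenPoly γ d n).Splits) ↔
    ∀ ρ : ℂ, riemannZeta ρ = 0 → 0 < ρ.re → ρ.re < 1 → H ≤ |ρ.im| → ρ.re = 1 / 2 :=
  ⟨offLineFreeAbove_of_deflatedJensen, deflatedJensen_of_offLineFreeAbove⟩

/-- RH gives every `B₂(H)` (the converse direction of the splitting, P1 discharged). -/
theorem deflatedJensen_of_rh (hRH : _root_.RiemannHypothesis) (H : ℝ) :
    ∃ (F : ℂ → ℂ) (γ : ℕ → ℝ),
      Differentiable ℂ F ∧
      (∀ R : ℝ, 0 ≤ R → Summable fun j => |γ j| / (j ! : ℝ) * R ^ j) ∧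
      (∀ w : ℂ, HasSum (fun j => (γ j : ℂ) / (j ! : ℂ) * w ^ j) (F w)) ∧
      F 0 ≠ 0 ∧
      (∀ w : ℂ, F w = 0 ↔
        ∃ ρ : ℂ, riemannZeta ρ = 0 ∧ 0 < ρ.re ∧ ρ.re < 1 ∧ H ≤ |ρ.im| ∧ w = (ρ - 1 / 2) ^ 2) ∧
      ∀ d n : ℕ, (jensenPoly γ d n).Splits :=
  deflatedJensen_of_offLineFreeAbove fun ρ hζ h0 h1 hH =>
    re_eq_half_of_im_sq_eq_zero hζ h0 h1
      (im_eq_zero_of_xiSq_eq_zero hRH (xiSq_eq_zero_of_deflatedZero ⟨ρ, hζ, h0, h1, hH, rfl⟩))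

/-- Given the FIN certificate `RH up to H` (any source), the TAIL `B₂(H)` IS RH. -/
theorem deflatedJensen_iff_rh {H : ℝ} (hA : RiemannHypothesisUpTo H) :
    (∃ (F : ℂ → ℂ) (γ : ℕ → ℝ),
      Differentiable ℂ F ∧
      (∀ R : ℝ, 0 ≤ R → Summable fun j => |γ j| / (j ! : ℝ) * R ^ j) ∧
      (∀ w : ℂ, HasSum (fun j => (γ j : ℂ) / (j ! : ℂ) * w ^ j) (F w)) ∧
      F 0 ≠ 0 ∧
      (∀ w : ℂ, F w = 0 ↔
        ∃ ρ : ℂ, riemannZeta ρ = 0 ∧ 0 < ρ.re ∧ ρ.re < 1 ∧ H ≤ |ρ.im| ∧ w = (ρ - 1 / 2) ^ 2) ∧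
      ∀ d n : ℕ, (jensenPoly γ d n).Splits) ↔
    _root_.RiemannHypothesis :=
  ⟨rh_of_rhUpTo_of_deflatedJensen hA, fun h => deflatedJensen_of_rh h H⟩

/-- **Label of the deflation TAIL at the kernel height: `B₂(1000) ↔ RH`, F1-free, standard axioms**
(FIN = the tree theorem `riemannHypothesisUpTo_1000`). -/
theorem deflatedJensen_1000_iff_rh :
    (∃ (F : ℂ → ℂ) (γ : ℕ → ℝ),
      Differentiable ℂ F ∧
      (∀ R : ℝ, 0 ≤ R → Summable fun j => |γ j| / (j ! : ℝ) * R ^ j) ∧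
      (∀ w : ℂ, HasSum (fun j => (γ j : ℂ) / (j ! : ℂ) * w ^ j) (F w)) ∧
      F 0 ≠ 0 ∧
      (∀ w : ℂ, F w = 0 ↔
        ∃ ρ : ℂ, riemannZeta ρ = 0 ∧ 0 < ρ.re ∧ ρ.re < 1 ∧ (1000 : ℝ) ≤ |ρ.im| ∧
          w = (ρ - 1 / 2) ^ 2) ∧
      ∀ d n : ℕ, (jensenPoly γ d n).Splits) ↔
    _root_.RiemannHypothesis :=
  deflatedJensen_iff_rh riemannHypothesisUpTo_1000

/-- Bookkeeping for the referee: under FIN(H) the raw tail `RH above H` is RH-EQUIVALENT too. -/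
theorem offLineFreeAbove_iff_rh {H : ℝ} (hA : RiemannHypothesisUpTo H) :
    (∀ ρ : ℂ, riemannZeta ρ = 0 → 0 < ρ.re → ρ.re < 1 → H ≤ |ρ.im| → ρ.re = 1 / 2) ↔
      _root_.RiemannHypothesis := by
  rw [← deflatedJensen_iff_offLineFreeAbove]; exact deflatedJensen_iff_rh hA

/-! ## §5 Census R10–R11: what a finite CELL set is worth, both ways (all RH-free) -/

/-- Shift ascent (Rolle down the anti-diagonal): `J^{d+1,n}_γ` hyperbolic ⇒ `J^{d,n+1}_γ` hyperbolic
(tree: `JensenLaguerreFlow.derivative_jensenPoly_succ` + `splits_derivative`). [folklore] -/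
theorem splits_jensenPoly_shift_of_succ {γ : ℕ → ℝ} {d n : ℕ} (h : (jensenPoly γ (d + 1) n).Splits) :
    (jensenPoly γ d (n + 1)).Splits := by
  have h2 := splits_derivative h
  rw [Literature.Analysis.Complex.JensenLaguerreFlow.derivative_jensenPoly_succ] at h2
  have hc : (C ((d : ℝ) + 1) : ℝ[X]) ≠ 0 := C_ne_zero.2 (by positivity)
  exact (splits_mul_iff_right hc (Splits.C _)).1 h2

/-- **R10 — the Rolle staircase: ONE row-`0` cell certifies a whole triangle.** `J^{D,0}_γ` hyperbolic ⇒
`J^{d,n}_γ` hyperbolic for all `d + n ≤ D` (shift ascent + degree descent `splits_jensenPoly_of_le`).  So the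
certification of ANY finite cell set reduces to the single cell `(D,0)`, `D = max (d+n)`. [folklore] -/
theorem splits_triangle_of_rowZero {γ : ℕ → ℝ} {D : ℕ} (h : (jensenPoly γ D 0).Splits) {d n : ℕ}
    (hdn : d + n ≤ D) : (jensenPoly γ d n).Splits := by
  have key : ∀ k m : ℕ, m + k = D → (jensenPoly γ m k).Splits := by
    intro k
    induction k with
    | zero => intro m hm; rw [add_zero] at hm; subst hm; exact h
    | succ k ih => intro m hm; exact splits_jensenPoly_shift_of_succ (ih (m + 1) (by omega))
  exact splits_jensenPoly_of_le (show d ≤ D - n by omega) (key n (D - n) (by omega))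

/-- The exchange THEOREM zero ⟶ cell, triangle form: `RH up to T` (any source) ⇒ every `J^{d,n}` of `ξ`
with `d + n ≤ T²` is hyperbolic (Chasse/Kim–Lee `jensenPoly_xiTaylorCoeff_splits_of_rh_upTo` + R10). -/
theorem splits_triangle_of_rh_upTo {T : ℝ} (hT : 0 < T)
    (hRH : ∀ s : ℂ, riemannZeta s = 0 → 0 < s.im → s.im < T → s.re = 1 / 2) {d n : ℕ}
    (hdn : ((d + n : ℕ) : ℝ) ≤ T ^ 2) : (jensenPoly xiTaylorCoeff d n).Splits :=
  splits_triangle_of_rowZero (jensenPoly_xiTaylorCoeff_splits_of_rh_upTo hT hRH hdn) le_rfl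

/-- **KERNEL FIN in cell currency: the triangle `d + n ≤ 10⁶` of the Jensen grid of `ξ` is hyperbolic**
(from the tree theorem `riemannHypothesisUpTo_1000`, standard axioms). -/
theorem splits_triangle_million {d n : ℕ} (hdn : d + n ≤ 1000000) :
    (jensenPoly xiTaylorCoeff d n).Splits := by
  refine splits_triangle_of_rh_upTo (T := 1000) (by norm_num)
    (fun s hs h0 hT => riemannHypothesisUpTo_1000 s hs h0 hT.le) ?_
  calc ((d + n : ℕ) : ℝ) ≤ ((1000000 : ℕ) : ℝ) := by exact_mod_cast hdn
    _ = (1000 : ℝ) ^ 2 := by norm_num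

/-- **R11 — what one certified cell buys back in zero currency** (RH-free contrapositive of the tree's
local criterion `xi_not_splits_of_local_criterion`, Chasse Thm 1.8 local form): a hyperbolic `J^{d,0}` of `ξ`
certifies that `G = xiSq` is zero-free on every disc `B(c,r)` with `r < |Im c|` on whose boundary the
degree-`d` Gaussian-lens error is dominated — discs bounded AWAY from the real axis only. -/
theorem xiSq_ne_zero_of_rowZero_splits {d : ℕ} (hd : 0 < d) (hs : (jensenPoly xiTaylorCoeff d 0).Splits)
    {c : ℂ} {r : ℝ} (hr : 0 < r) (hrim : r < |c.im|)
    (hloc : ∀ w : ℂ, ‖w - c‖ = r →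
      Literature.Analysis.Complex.JensenCircleKernel.localErr (fun w => 8 * xiSq w) d w < 8 * ‖xiSq w‖)
    {η : ℂ} (hη : ‖η - c‖ < r) : xiSq η ≠ 0 :=
  fun hG => xi_not_splits_of_local_criterion hr hrim hη hG hd hloc hs

end Summit.RiemannHypothesis.RiemannHypothesis.Theorems.Splittings.JenDeflation

end
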